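import Summits.Parity.GeneralizedHardyLittlewood.Theorems.LeeYangFibresRelativeDimOneSplitClassMomentsCore
import HarnessLib

/-!
# Moving class errors: the `ℓ¹` bound along a moving window
(crux stmt-Parity-14113 `LeeYangFibres.RelativeDimOne`, line gallagher-backwards-split, aux for stub
`stub_classMoments`)

`movingClassError`: from `LowClassSecondMoment θ₁` (a HYPOTHESIS), for `0 ≤ θ₁' < θ₁ < 1`: for moduli
`q ≤ N^{θ₁'}`, a multiplier `0 < |a| ≤ L`, shifts `v, c` and a range `n < W` (`W ≥ δN`) on which the
heights `a n + v` stay in `[δN, LN]`,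
`∑_{n<W} |ψ(a n + v; q, a n + c) − 1_{(a n + c, q)=1} (a n + v)/φ(q)| ≤ ε W N/φ(q)` for `N ≥ N₀`.

Proof: Cauchy–Schwarz in `n`; the range `n < W` is cut into `≤ 2W/m` blocks of `m ≍ q/|a|`
consecutive integers, each contributing `≤ 2V + 2mω²` (`block_moving_sq_le`: distinct classes inside a
block, height wobble `ω = 3 log((L+1)N) + q/φ(q)` with `ωφ(q) ≤ εN/3`), where
`V = ε' ((L+1)N)²/φ(q)` bounds the class variance at every height in `[δN, LN]`
(`classVariance_of_lowClassSecondMoment` at level `θ₁`, using `q ≤ N^{θ₁'} ≤ (δN)^{θ₁}` for `N`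
large) and `ε' = ε²/(16 (L+1)³)`; then `∑_n err² ≤ ε² W N²/φ(q)²`.
-/

noncomputable section

open scoped BigOperators Classical Topology ArithmeticFunction.vonMangoldt
open Finset Filter Literature.NumberTheory.Sieve
open Summit.Parity.GeneralizedHardyLittlewood.Cruxes.RelativeDimOne.GallagherBackwards (classPsi)

namespace Summit.Parity.GeneralizedHardyLittlewood.Cruxes.RelativeDimOne.GallagherBackwardsSplit

namespace ClassMomentsCore

/-- Eventual scale conditions: level transfer `N^{θ₁'} ≤ (δN)^{θ₁}`, `N^{θ₁'} ≤ δN`, `X ≤ δN`,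
the wobble `N^{θ₁'} (3 log(L₁ N) + 1) ≤ κ N`, and `1 ≤ N`. -/
theorem eventually_scale {θ₁ θ₁' : ℝ} (hθ0 : 0 ≤ θ₁') (hθ' : θ₁' < θ₁) (hθ1 : θ₁ < 1)
    {δ κ L₁ : ℝ} (hδ : 0 < δ) (hκ : 0 < κ) (hL₁ : 1 ≤ L₁) (X : ℝ) :
    ∀ᶠ N : ℝ in atTop, N ^ θ₁' ≤ (δ * N) ^ θ₁ ∧ N ^ θ₁' ≤ δ * N ∧ X ≤ δ * N ∧
      N ^ θ₁' * (3 * Real.log (L₁ * N) + 1) ≤ κ * N ∧ 1 ≤ N := by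
  have e1 := (tendsto_rpow_atTop (sub_pos.2 hθ')).eventually_ge_atTop (δ ^ (-θ₁))
  have e2 := (tendsto_rpow_atTop (by linarith : (0 : ℝ) < 1 - θ₁')).eventually_ge_atTop δ⁻¹
  have e3 := (Filter.tendsto_id.const_mul_atTop hδ).eventually_ge_atTop X
  have e4 := (isLittleO_log_rpow_atTop (by linarith : (0 : ℝ) < 1 - θ₁')).def
    (by positivity : (0 : ℝ) < κ / 7)
  filter_upwards [e1, e2, e3, e4, eventually_ge_atTop (max L₁ 3)] with N h1 h2 h3 h4 h5
  have hN3 : 3 ≤ N := le_trans (le_max_right _ _) h5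
  have hNL : L₁ ≤ N := le_trans (le_max_left _ _) h5
  have hN0 : 0 < N := by linarith
  have hN1 : 1 ≤ N := by linarith
  refine ⟨?_, ?_, by simpa using h3, ?_, hN1⟩
  · -- level transfer
    rw [Real.mul_rpow hδ.le hN0.le]
    have hsplit : N ^ θ₁ = N ^ θ₁' * N ^ (θ₁ - θ₁') := by
      rw [← Real.rpow_add hN0]; ring_nf
    rw [hsplit]
    have hone : 1 ≤ δ ^ θ₁ * N ^ (θ₁ - θ₁') := by
      calc (1 : ℝ) = δ ^ θ₁ * δ ^ (-θ₁) := by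
            rw [← Real.rpow_add hδ]; simp
        _ ≤ δ ^ θ₁ * N ^ (θ₁ - θ₁') :=
            mul_le_mul_of_nonneg_left h1 (Real.rpow_nonneg hδ.le _)
    have hpow : 0 ≤ N ^ θ₁' := Real.rpow_nonneg hN0.le _
    calc N ^ θ₁' = N ^ θ₁' * 1 := (mul_one _).symm
      _ ≤ N ^ θ₁' * (δ ^ θ₁ * N ^ (θ₁ - θ₁')) := mul_le_mul_of_nonneg_left hone hpow
      _ = δ ^ θ₁ * (N ^ θ₁' * N ^ (θ₁ - θ₁')) := by ring
  · -- `N^{θ₁'} ≤ δ N`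
    have hsplit : N = N ^ θ₁' * N ^ (1 - θ₁') := by
      rw [← Real.rpow_add hN0]; norm_num
    have hpow : 0 ≤ N ^ θ₁' := Real.rpow_nonneg hN0.le _
    calc N ^ θ₁' = δ * (N ^ θ₁' * δ⁻¹) := by field_simp
      _ ≤ δ * (N ^ θ₁' * N ^ (1 - θ₁')) := by
          apply mul_le_mul_of_nonneg_left _ hδ.le
          exact mul_le_mul_of_nonneg_left h2 hpow
      _ = δ * N := by rw [← hsplit]
  · -- wobble
    have hl : 0 ≤ Real.log N := Real.log_nonneg hN1
    rw [Real.norm_of_nonneg hl, Real.norm_of_nonneg (Real.rpow_nonneg hN0.le _)] at h4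
    have hlogN1 : 1 ≤ Real.log N := by
      rw [← Real.log_exp 1]
      refine Real.log_le_log (Real.exp_pos 1) ?_
      have := Real.exp_one_lt_d9
      linarith
    have hlogL : Real.log (L₁ * N) ≤ 2 * Real.log N := by
      rw [Real.log_mul (by linarith) hN0.ne']
      have := Real.log_le_log (by linarith) hNL
      linarith
    have hsplit : N = N ^ θ₁' * N ^ (1 - θ₁') := by
      rw [← Real.rpow_add hN0]; norm_num
    have hpow : 0 ≤ N ^ θ₁' := Real.rpow_nonneg hN0.le _
    calc N ^ θ₁' * (3 * Real.log (L₁ * N) + 1) ≤ N ^ θ₁' * (7 * Real.log N) := by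
          apply mul_le_mul_of_nonneg_left _ hpow; linarith
      _ ≤ N ^ θ₁' * (7 * (κ / 7 * N ^ (1 - θ₁'))) := by
          apply mul_le_mul_of_nonneg_left _ hpow; linarith
      _ = κ * (N ^ θ₁' * N ^ (1 - θ₁')) := by ring
      _ = κ * N := by rw [← hsplit]

/-- The block length `m = max 1 (q / A)`: `A (m − 1) < q`. -/
theorem blockLen_mul_lt {q A : ℕ} (hq : 0 < q) (hA : 0 < A) : A * (max 1 (q / A) - 1) < q := by
  rcases Nat.eq_zero_or_pos (q / A) with h0 | hpos
  · rw [h0]; simpa using hq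
  · rw [max_eq_right hpos]
    calc A * (q / A - 1) < A * (q / A) := (Nat.mul_lt_mul_left hA).2 (Nat.sub_lt hpos one_pos)
      _ ≤ q := Nat.mul_div_le q A

/-- The block length `m = max 1 (q / A)`: `q ≤ 2 L m` when `A ≤ L`. -/
theorem le_two_mul_blockLen {q A L : ℕ} (hA : 0 < A) (hAL : A ≤ L) :
    (q : ℝ) ≤ 2 * L * (max 1 (q / A) : ℕ) := by
  have h1 : q < A * (q / A + 1) := by
    have := Nat.lt_div_mul_add (a := q) hA
    rw [Nat.mul_add, Nat.mul_one, Nat.mul_comm]; exact this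
  have h2 : q / A + 1 ≤ max 1 (q / A) + 1 := Nat.add_le_add_right (le_max_right _ _) 1
  have h3 : (q : ℝ) < A * ((max 1 (q / A) : ℕ) + 1) := by
    have : q < A * (max 1 (q / A) + 1) := lt_of_lt_of_le h1 (Nat.mul_le_mul_left _ h2)
    exact_mod_cast this
  have h4 : (A : ℝ) ≤ L := by exact_mod_cast hAL
  have h5 : (1 : ℝ) ≤ (max 1 (q / A) : ℕ) := by exact_mod_cast le_max_left 1 (q / A)
  have h6 : (0 : ℝ) ≤ (max 1 (q / A) : ℕ) + 1 := by positivity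
  have hL0 : (0 : ℝ) ≤ L := Nat.cast_nonneg L
  nlinarith [mul_le_mul_of_nonneg_right h4 h6, mul_le_mul_of_nonneg_left h5 hL0]

/-- A block `{n < W : n / m = k}` has at most `m` elements. -/
theorem card_block_le (W m k : ℕ) (hm : 0 < m) :
    #((range W).filter (fun n => n / m = k)) ≤ m := by
  calc #((range W).filter (fun n => n / m = k)) ≤ #(Ico (m * k) (m * k + m)) := by
        apply card_le_card
        intro n hn
        have h := (mem_filter.1 hn).2
        rw [mem_Ico]
        have h1 := Nat.div_add_mod n m
        have h2 := Nat.mod_lt n hm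
        rw [h] at h1
        omega
    _ = m := by rw [Nat.card_Ico]; omega

/-- Endgame arithmetic of `movingClassError`. -/
theorem endgame {T K m W V ω φ ε ε' L₁ N : ℝ} (hT : T ≤ K * (2 * V + 2 * m * ω ^ 2))
    (hm : 0 < m) (hKm : K * m ≤ 2 * W) (hW : 0 ≤ W) (hV0 : 0 ≤ V) (hφ0 : 0 < φ)
    (hφm : φ ≤ 2 * L₁ * m) (hVφ : V * φ = ε' * (L₁ * N) ^ 2) (hε' : ε' = ε ^ 2 / (16 * L₁ ^ 3))
    (hL₁ : 1 ≤ L₁) (hω0 : 0 ≤ ω) (hωφ : ω * φ ≤ ε / 3 * N) (hεN : 0 ≤ ε * N) :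
    T * φ ^ 2 ≤ ε ^ 2 * W * N ^ 2 := by
  have hpos : 0 ≤ 2 * V + 2 * m * ω ^ 2 := by positivity
  have h1 : T * m ≤ 2 * W * (2 * V + 2 * m * ω ^ 2) := by
    calc T * m ≤ K * (2 * V + 2 * m * ω ^ 2) * m := mul_le_mul_of_nonneg_right hT hm.le
      _ = (K * m) * (2 * V + 2 * m * ω ^ 2) := by ring
      _ ≤ 2 * W * (2 * V + 2 * m * ω ^ 2) := mul_le_mul_of_nonneg_right hKm hpos
  have h2 : T * m * φ ^ 2 ≤ 4 * W * (V * φ) * φ + 4 * W * m * (ω * φ) ^ 2 := by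
    have := mul_le_mul_of_nonneg_right h1 (sq_nonneg φ)
    calc T * m * φ ^ 2 ≤ 2 * W * (2 * V + 2 * m * ω ^ 2) * φ ^ 2 := this
      _ = 4 * W * (V * φ) * φ + 4 * W * m * (ω * φ) ^ 2 := by ring
  have h3 : 4 * W * (V * φ) * φ ≤ 4 * W * (ε' * (L₁ * N) ^ 2) * (2 * L₁ * m) := by
    rw [hVφ]
    apply mul_le_mul_of_nonneg_left hφm
    rw [hε']; positivity
  have h4 : 4 * W * m * (ω * φ) ^ 2 ≤ 4 * W * m * (ε / 3 * N) ^ 2 := by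
    apply mul_le_mul_of_nonneg_left _ (by positivity)
    exact sq_le_sq' (by nlinarith [mul_nonneg hω0 hφ0.le]) hωφ
  have h5 : 4 * W * (ε' * (L₁ * N) ^ 2) * (2 * L₁ * m) = ε ^ 2 / 2 * W * N ^ 2 * m := by
    rw [hε']
    have hL0 : L₁ ≠ 0 := by positivity
    field_simp
    ring
  have h6 : 4 * W * m * (ε / 3 * N) ^ 2 = 4 / 9 * (ε ^ 2 * W * N ^ 2 * m) := by ring
  have h7 : 0 ≤ ε ^ 2 * W * N ^ 2 * m := by positivity
  have h8 : T * φ ^ 2 * m ≤ ε ^ 2 * W * N ^ 2 * m := by nlinarith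
  exact le_of_mul_le_mul_right h8 hm

end ClassMomentsCore

open ClassMomentsCore in
/-- **Moving class errors** (registered auxiliary of stub `stub_classMoments`). Assuming
`LowClassSecondMoment θ₁`, `0 ≤ θ₁' < θ₁ < 1`: for all `L, δ, ε` there is `N₀` such that for
`N ≥ N₀`, every modulus `1 ≤ q ≤ N^{θ₁'}`, every multiplier `a ≠ 0`, `|a| ≤ L`, all shifts `v, c` and
every range `n < W` with `W ≥ δN` on which `δN ≤ a n + v ≤ LN`:
`∑_{n<W} |ψ(a n + v; q, (a n + c) mod q) − 1_{gcd(a n + c, q) = 1} (a n + v)/φ(q)| ≤ ε W N/φ(q)`. -/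
theorem movingClassError : ∀ θ₁ θ₁' : ℝ, 0 ≤ θ₁' → θ₁' < θ₁ → θ₁ < 1 → LowClassSecondMoment θ₁ → ∀ L : ℕ, ∀ δ ε : ℝ, 0 < δ → 0 < ε → ∃ N₀ : ℕ, ∀ N : ℕ, N₀ ≤ N → ∀ q : ℕ, 1 ≤ q → (q : ℝ) ≤ (N : ℝ) ^ θ₁' → ∀ a v c : ℤ, a ≠ 0 → |a| ≤ L → ∀ W : ℕ, δ * N ≤ W → (∀ n : ℕ, n < W → δ * N ≤ ((a * n + v : ℤ) : ℝ) ∧ ((a * n + v : ℤ) : ℝ) ≤ L * N) → ∑ n ∈ Finset.range W, |classPsi (a * n + v).toNat q (resid q (a * n + c)) - if Int.gcd (a * n + c) q = 1 then ((a * n + v : ℤ) : ℝ) / Nat.totient q else 0| ≤ ε * W * N / Nat.totient q := by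
  intro θ₁ θ₁' hθ0 hθ' hθ1 hLow L δ ε hδ hε
  set L₁ : ℝ := (L : ℝ) + 1 with hL₁
  have hL0 : (0 : ℝ) ≤ L := Nat.cast_nonneg L
  have hL₁1 : 1 ≤ L₁ := by rw [hL₁]; linarith
  set ε' : ℝ := ε ^ 2 / (16 * L₁ ^ 3) with hε'
  have hε'0 : 0 < ε' := by positivity
  obtain ⟨x₀, hx₀⟩ := classVariance_of_lowClassSecondMoment θ₁ hθ1 hLow ε' hε'0
  obtain ⟨N₀, hN₀⟩ := BrunTitchmarshAP.exists_nat_of_eventually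
    (eventually_scale hθ0 hθ' hθ1 hδ (by positivity : (0 : ℝ) < ε / 3) hL₁1 (x₀ : ℝ))
  refine ⟨N₀, fun N hN q hq hqN a v c ha haL W hW hwin => ?_⟩
  obtain ⟨c1, c2, c3, c4, c5⟩ := hN₀ N hN
  -- positivity
  have hN0 : (0 : ℝ) < N := by linarith
  have hδN : 0 < δ * N := mul_pos hδ hN0
  have hq0 : 0 < q := hq
  have hqR : (0 : ℝ) < q := by exact_mod_cast hq0
  set φ : ℝ := (Nat.totient q : ℝ) with hφ
  have hφ0 : 0 < φ := by rw [hφ]; exact_mod_cast Nat.totient_pos.2 hq0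
  have hφq : φ ≤ q := by rw [hφ]; exact_mod_cast Nat.totient_le q
  have hθ1pos : 0 ≤ θ₁ := hθ0.trans hθ'.le
  -- the multiplier and the block length
  set A : ℕ := a.natAbs with hA
  have hA0 : 0 < A := Int.natAbs_pos.2 ha
  have hAL : A ≤ L := by
    have : (A : ℤ) ≤ L := by rw [hA, Int.natCast_natAbs]; exact haL
    exact_mod_cast this
  set m : ℕ := max 1 (q / A) with hm
  have hm0 : 0 < m := lt_of_lt_of_le one_pos (le_max_left _ _)
  have hmq_nat : m ≤ q := max_le hq (Nat.div_le_self q A)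
  have hAm : A * (m - 1) < q := blockLen_mul_lt hq0 hA0
  have hqm : (q : ℝ) ≤ 2 * L * m := le_two_mul_blockLen hA0 hAL
  have hmR : (0 : ℝ) < m := by exact_mod_cast hm0
  -- heights along the window
  have hH1 : ∀ n, n < W → (1 : ℤ) ≤ a * n + v := by
    intro n hn
    have h1 : (0 : ℝ) < ((a * n + v : ℤ) : ℝ) := lt_of_lt_of_le hδN (hwin n hn).1
    have h2 : (0 : ℤ) < a * n + v := by exact_mod_cast h1
    omega
  have hHY : ∀ n, n < W → ((a * n + v : ℤ) : ℝ) ≤ L₁ * N := by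
    intro n hn
    refine (hwin n hn).2.trans ?_
    rw [hL₁]; nlinarith
  have hHcast : ∀ n, n < W → (((a * n + v).toNat : ℕ) : ℝ) = ((a * n + v : ℤ) : ℝ) := by
    intro n hn
    rw [← Int.cast_natCast, Int.toNat_of_nonneg (by linarith [hH1 n hn])]
  -- the class error and the heights
  set F : ℕ → ℕ → ℝ := fun x r =>
    classPsi x q r - if r.Coprime q then (x : ℝ) / Nat.totient q else 0 with hF
  set H : ℕ → ℕ := fun n => (a * n + v).toNat with hH
  -- class variance at every height of the window
  set V : ℝ := ε' * (L₁ * N) ^ 2 / φ with hV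
  have hV0 : 0 ≤ V := by positivity
  have hvar : ∀ n, n < W → ∑ r ∈ range q, F (H n) r ^ 2 ≤ V := by
    intro n hn
    have hxR := hHcast n hn
    have hx_ge : δ * N ≤ (((a * n + v).toNat : ℕ) : ℝ) := hxR ▸ (hwin n hn).1
    have hx₀x : x₀ ≤ (a * n + v).toNat := by
      have : (x₀ : ℝ) ≤ ((a * n + v).toNat : ℕ) := c3.trans hx_ge
      exact_mod_cast this
    have hqx : (q : ℝ) ≤ (((a * n + v).toNat : ℕ) : ℝ) ^ θ₁ :=
      hqN.trans (c1.trans (Real.rpow_le_rpow hδN.le hx_ge hθ1pos))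
    have h := hx₀ _ hx₀x q hq hqx
    have hxY : (((a * n + v).toNat : ℕ) : ℝ) ≤ L₁ * N := hxR ▸ hHY n hn
    calc ∑ r ∈ range q, F (H n) r ^ 2
        ≤ ε' * (((a * n + v).toNat : ℕ) : ℝ) ^ 2 / Nat.totient q := h
      _ ≤ ε' * (L₁ * N) ^ 2 / φ := by
          apply div_le_div_of_nonneg_right _ hφ0.le
          apply mul_le_mul_of_nonneg_left _ hε'0.le
          exact pow_le_pow_left₀ (Nat.cast_nonneg _) hxY 2
  -- the wobble
  set ω : ℝ := 3 * Real.log (L₁ * N) + q / φ with hω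
  have hLN1 : 1 ≤ L₁ * N := by nlinarith
  have hlogY : 0 ≤ Real.log (L₁ * N) := Real.log_nonneg hLN1
  have hω0 : 0 ≤ ω := by positivity
  have hωφ : ω * φ ≤ ε / 3 * N := by
    have h1 : ω * φ = 3 * φ * Real.log (L₁ * N) + q := by
      rw [hω]; field_simp
    rw [h1]
    calc 3 * φ * Real.log (L₁ * N) + q ≤ 3 * q * Real.log (L₁ * N) + q := by nlinarith
      _ = q * (3 * Real.log (L₁ * N) + 1) := by ring
      _ ≤ (N : ℝ) ^ θ₁' * (3 * Real.log (L₁ * N) + 1) :=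
          mul_le_mul_of_nonneg_right hqN (by positivity)
      _ ≤ ε / 3 * N := c4
  -- wobble between two heights of a block
  have hwob : ∀ k : ℕ, ∀ n ∈ (range W).filter (fun n => n / m = k),
      ∀ n' ∈ (range W).filter (fun n => n / m = k), ∀ r : ℕ, |F (H n) r - F (H n') r| ≤ ω := by
    intro k n hn n' hn' r
    rw [mem_filter, mem_range] at hn hn'
    refine abs_classErr_toNat_sub_le hq0 (hH1 n hn.1) (hH1 n' hn'.1) ?_ (hHY n hn.1)
      (hHY n' hn'.1) r
    have key : a * (n : ℤ) + v - (a * n' + v) = a * ((n : ℤ) - n') := by ring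
    rw [key]
    exact natAbs_mul_sub_lt hm0 hAm hn'.2 hn.2
  -- the error terms
  set E : ℕ → ℝ := fun n => F (H n) (resid q (a * n + c)) with hE
  have hsummand : ∀ n ∈ range W,
      |classPsi (a * n + v).toNat q (resid q (a * n + c)) -
        if Int.gcd (a * n + c) q = 1 then ((a * n + v : ℤ) : ℝ) / Nat.totient q else 0| = |E n| := by
    intro n hn
    rw [mem_range] at hn
    simp only [hE, hF, hH, coprime_resid_iff hq0, hHcast n hn]
  rw [sum_congr rfl hsummand]
  -- blocks
  set K : ℕ := W / m + 1 with hK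
  have hblocks : ∑ n ∈ range W, E n ^ 2 =
      ∑ k ∈ range K, ∑ n ∈ (range W).filter (fun n => n / m = k), E n ^ 2 := by
    symm
    apply sum_fiberwise_of_maps_to
    intro n hn
    rw [mem_range] at hn ⊢
    exact Nat.lt_succ_of_le (Nat.div_le_div_right hn.le)
  have hblock : ∀ k ∈ range K,
      ∑ n ∈ (range W).filter (fun n => n / m = k), E n ^ 2 ≤ 2 * V + 2 * m * ω ^ 2 := by
    intro k _
    exact block_moving_sq_le q a c m k _ H F V ω hq0 ha hm0 hAm hV0 hω0
      (fun n hn => (mem_filter.1 hn).2) (card_block_le W m k hm0) (hwob k)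
      (fun n hn => hvar n (mem_range.1 (mem_filter.1 hn).1))
  set T : ℝ := ∑ n ∈ range W, E n ^ 2 with hTdef
  have hT : T ≤ K * (2 * V + 2 * m * ω ^ 2) := by
    rw [hblocks]
    calc _ ≤ ∑ k ∈ range K, (2 * V + 2 * m * ω ^ 2) := sum_le_sum hblock
      _ = K * (2 * V + 2 * m * ω ^ 2) := by rw [sum_const, card_range, nsmul_eq_mul]
  -- `K m ≤ 2W`
  have hmW : (m : ℝ) ≤ W := by
    have : (m : ℝ) ≤ q := by exact_mod_cast hmq_nat
    exact this.trans (hqN.trans (c2.trans hW))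
  have hKm : (K : ℝ) * m ≤ 2 * W := by
    rw [hK]; push_cast
    have h1 : ((W / m : ℕ) : ℝ) ≤ (W : ℝ) / m := Nat.cast_div_le
    have h2 : ((W / m : ℕ) : ℝ) * m ≤ W := (le_div_iff₀ hmR).1 h1
    calc (((W / m : ℕ) : ℝ) + 1) * m = ((W / m : ℕ) : ℝ) * m + m := by ring
      _ ≤ W + W := add_le_add h2 hmW
      _ = 2 * W := by ring
  -- endgame
  have hφm : φ ≤ 2 * L₁ * m := by
    have : (2 : ℝ) * L * m ≤ 2 * L₁ * m := by
      apply mul_le_mul_of_nonneg_right _ hmR.le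
      rw [hL₁]; linarith
    exact hφq.trans (hqm.trans this)
  have hVφ : V * φ = ε' * (L₁ * N) ^ 2 := by rw [hV]; field_simp
  have hmain : T * φ ^ 2 ≤ ε ^ 2 * W * N ^ 2 :=
    endgame hT hmR hKm (Nat.cast_nonneg W) hV0 hφ0 hφm hVφ hε' hL₁1 hω0 hωφ (by positivity)
  -- Cauchy–Schwarz and conclusion
  have hCS : (∑ n ∈ range W, |E n|) ^ 2 ≤ W * T := by
    have := sq_sum_le_card_mul_sum_sq (s := range W) (f := fun n => |E n|)
    rw [card_range] at this
    simpa only [sq_abs] using this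
  have hfinal : (∑ n ∈ range W, |E n|) ^ 2 ≤ (ε * W * N / φ) ^ 2 := by
    have hWN : (W : ℝ) * T ≤ (ε * W * N / φ) ^ 2 := by
      rw [div_pow, le_div_iff₀ (by positivity)]
      calc (W : ℝ) * T * φ ^ 2 = W * (T * φ ^ 2) := by ring
        _ ≤ W * (ε ^ 2 * W * N ^ 2) := mul_le_mul_of_nonneg_left hmain (Nat.cast_nonneg W)
        _ = (ε * W * N) ^ 2 := by ring
    exact hCS.trans hWN
  have hnonneg : 0 ≤ ε * W * N / φ := by positivity
  exact (abs_le_of_sq_le_sq' hfinal hnonneg).2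

end Summit.Parity.GeneralizedHardyLittlewood.Cruxes.RelativeDimOne.GallagherBackwardsSplit
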